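import Summits.NavierStokesRegularity.NavierStokesRegularity.Theorems.PerpetualPumpAveragedTypeIBlowupPulse

/-!
# Crux `PerpetualPump.AveragedTypeIBlowup` (stmt-NavierStokesRegularity-1835), line `Sketch`:
# truncation-friendly companions of the stub `pulse`

Two registered sub-goals requested by the lead for the TRUNCATED pulse (the solution of the forced
gate `b' = -b - w² + f₁`, `w' = w(b - β - 1) + f₂`, `β' = -q⁴β + w² + f₃` known only on some horizon
`[0, σ₁]`, `σ₁ ≤ 1/10`, with no lower bound on `σ₁`), both with the hypotheses of
`stub_pulseEnvelope`:

* `stub_pulseLowerTrunc` — the old carrier never drops below `-1/2` (the previous bond's rate uses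
  `-b/q`): `b ≥ -43/500` in a gate phase, `b ≥ -1/5` in the dead phase.
* `stub_pulseRise` — the RISE of the next carrier costs no amplification budget: while `β ≤ B/4`,
  `∫₀^σ |β| ≤ 1` (the clock is still in its first half there, and `(1-u)` grows exponentially, so
  its time integral is `O(1/B)` while `|β| ≤ 1/50 + 0.5005 B (1-u)`).

Both follow from the phase structure `pulse_first_passage` / `pulse_gate_exit` / `pulse_dead` of
`…Pulse.lean`.

## References

Folklore ODE comparison arguments; the gate is the Toda-type transfer step of T. Tao, *Finite time
blowup for an averaged three-dimensional Navier–Stokes equation*, J. Amer. Math. Soc. 29 (2016),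
601–674, §5.4–5.5.
-/

noncomputable section

-- the summit namespace `…NavierStokesRegularity.NavierStokesRegularity…` is the tree convention
set_option linter.dupNamespace false

open MeasureTheory Set Filter Topology

namespace Summit.NavierStokesRegularity.NavierStokesRegularity.Theorems.PerpetualPumpAveragedTypeIBlowup

/-- **Registered sub-goal `stub_pulseLowerTrunc`** (truncation-friendly companion of `stub_pulse`):
on ANY horizon `σ₁ ≤ 1/10` the old carrier stays `≥ -1/2` (in fact `≥ -1/5`): by
`pulse_first_passage` either `[0, σ₁]` is a gate phase, where `b ≥ (P-R)/2 ≥ -43/500`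
(`pulse_gate_clock`), or the bond exits at some `T < σ₁`, after which the dead phase gives
`b ≥ -0.09 - 1.1(σ - T) ≥ -1/5` (`pulse_gate_exit`, `pulse_dead`). [folklore] -/
theorem stub_pulseLowerTrunc :
    ∀ (b w β f₁ f₂ f₃ : ℝ → ℝ) (B q4 φ σ₁ : ℝ),
      10 ^ 4 ≤ B → 1 ≤ q4 → q4 ≤ 111 / 100 → 0 ≤ φ → φ ≤ 1 / 2000 → σ₁ ≤ 1 / 10 →
      ContinuousOn b (Icc 0 σ₁) → ContinuousOn w (Icc 0 σ₁) → ContinuousOn β (Icc 0 σ₁) →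
      (∀ σ ∈ Ioo 0 σ₁, HasDerivAt b (-(b σ) - (w σ) ^ 2 + f₁ σ) σ) →
      (∀ σ ∈ Ioo 0 σ₁, HasDerivAt w (w σ * (b σ - β σ - 1) + f₂ σ) σ) →
      (∀ σ ∈ Ioo 0 σ₁, HasDerivAt β (-(q4 * β σ) + (w σ) ^ 2 + f₃ σ) σ) →
      (∀ σ ∈ Icc 0 σ₁, |f₁ σ| ≤ φ ∧ |f₂ σ| ≤ φ ∧ |f₃ σ| ≤ φ) →
      b 0 = B → w 0 = Real.sqrt B / 10 → |β 0| ≤ 1 / 50 →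
      ∀ σ ∈ Icc 0 σ₁, -(1 / 2) ≤ b σ := by
  intro b w β f₁ f₂ f₃ B q4 φ σ₁ hB hq1 hq2 hφ0 hφ1 hσ₁ hbc hwc hβc hbd hwd hβd hf hb0 hw0 hβ0 σ hσ
  have hB0 : 0 < B := lt_of_lt_of_le (by norm_num) hB
  rcases hσ.1.eq_or_lt with h0 | hσ0
  · rw [← h0, hb0]; linarith
  have hσ₁0 : 0 < σ₁ := hσ0.trans_le hσ.2
  obtain ⟨R, hR⟩ : ∃ R : ℝ → ℝ, R = fun s => Real.sqrt ((b s - β s) ^ 2 + 2 * (w s) ^ 2) := ⟨_, rfl⟩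
  obtain ⟨U, hU⟩ : ∃ U : ℝ → ℝ, U = fun s => (b s - β s) / R s := ⟨_, rfl⟩
  rcases pulse_first_passage b w β f₁ f₂ f₃ R U B q4 φ σ₁ hB hq1 hq2 hφ0 hφ1 hσ₁ hbc hwc hβc hbd hwd
    hβd hf hb0 hw0 hβ0 hR hU hσ₁0 with ⟨hall, hBσ₁⟩ | ⟨T, hT0, hTσ₁, hTB, hw1, hwT⟩
  · obtain ⟨-, hcl⟩ := pulse_gate_clock b w β f₁ f₂ f₃ R U B q4 φ σ₁ σ₁ hB hq1 hq2 hφ0 hφ1 hσ₁ hbc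
      hwc hβc hbd hwd hβd hf hb0 hw0 hβ0 hR hU hσ₁0 le_rfl hBσ₁ hall
    linarith [(hcl σ hσ).2.2.1]
  · obtain ⟨-, hcl⟩ := pulse_gate_clock b w β f₁ f₂ f₃ R U B q4 φ σ₁ T hB hq1 hq2 hφ0 hφ1 hσ₁ hbc
      hwc hβc hbd hwd hβd hf hb0 hw0 hβ0 hR hU hT0 hTσ₁.le hTB hw1
    rcases le_or_gt σ T with h | h
    · linarith [(hcl σ ⟨hσ.1, h⟩).2.2.1]
    · obtain ⟨σm, -, -, -, -, -, -, -, hbT, -, hβT⟩ := pulse_gate_exit b w β f₁ f₂ f₃ R U B q4 φ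
        σ₁ T hB hq1 hq2 hφ0 hφ1 hσ₁ hbc hwc hβc hbd hwd hβd hf hb0 hw0 hβ0 hR hU hT0 hTσ₁.le hTB hw1
        hwT
      have hdead := pulse_dead b w β f₁ f₂ f₃ B q4 φ σ₁ T hB hq1 hq2 hφ0 hφ1 hσ₁ hbc hwc hβc hbd hwd
        hβd hf hb0 hw0 hβ0 hT0 hTσ₁.le (by rw [hwT, abs_one]) hbT
        (hcl T (right_mem_Icc.2 hT0.le)).2.2.1 hβT
      linarith [(hdead σ ⟨h.le, hσ.2⟩).2.1]

/-- **Registered sub-goal `stub_pulseRise`** (truncation-friendly companion of `stub_pulse`, the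
RISE of the next carrier): on any horizon `σ₁ ≤ 1/10`, as long as `β ≤ B/4` the accumulated
`∫ |β|` is `≤ 1` (in fact `≤ 0.27`). Indeed such times lie in a gate phase (`β ≥ 0.996 B` at an
exit), where `β = (P-R)/2 + R(1-u)/2 ≤ B/4` forces `1 - u ≤ 0.51`, so the clock is still in its
first half (`u > 0`), `(1-u)' ≥ (49B/50)(1-u) - 1/(1000B)` integrates to
`(49B/50)∫(1-u) ≤ 0.51 + 10⁻⁵`, and `|β| ≤ 1/50 + 0.5005 B (1-u)`. [folklore] -/
theorem stub_pulseRise :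
    ∀ (b w β f₁ f₂ f₃ : ℝ → ℝ) (B q4 φ σ₁ : ℝ),
      10 ^ 4 ≤ B → 1 ≤ q4 → q4 ≤ 111 / 100 → 0 ≤ φ → φ ≤ 1 / 2000 → σ₁ ≤ 1 / 10 →
      ContinuousOn b (Icc 0 σ₁) → ContinuousOn w (Icc 0 σ₁) → ContinuousOn β (Icc 0 σ₁) →
      (∀ σ ∈ Ioo 0 σ₁, HasDerivAt b (-(b σ) - (w σ) ^ 2 + f₁ σ) σ) →
      (∀ σ ∈ Ioo 0 σ₁, HasDerivAt w (w σ * (b σ - β σ - 1) + f₂ σ) σ) →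
      (∀ σ ∈ Ioo 0 σ₁, HasDerivAt β (-(q4 * β σ) + (w σ) ^ 2 + f₃ σ) σ) →
      (∀ σ ∈ Icc 0 σ₁, |f₁ σ| ≤ φ ∧ |f₂ σ| ≤ φ ∧ |f₃ σ| ≤ φ) →
      b 0 = B → w 0 = Real.sqrt B / 10 → |β 0| ≤ 1 / 50 →
      ∀ σ ∈ Icc 0 σ₁, (∀ u ∈ Icc 0 σ, β u ≤ B / 4) → ∫ u in (0 : ℝ)..σ, |β u| ≤ 1 := by
  intro b w β f₁ f₂ f₃ B q4 φ σ₁ hB hq1 hq2 hφ0 hφ1 hσ₁ hbc hwc hβc hbd hwd hβd hf hb0 hw0 hβ0 σ hσ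
    hβ4
  have hB0 : 0 < B := lt_of_lt_of_le (by norm_num) hB
  have hK0 : (0 : ℝ) < 49 * B / 50 := by positivity
  rcases hσ.1.eq_or_lt with h0 | hσ0
  · rw [← h0, intervalIntegral.integral_same]; norm_num
  have hσ₁0 : 0 < σ₁ := hσ0.trans_le hσ.2
  obtain ⟨R, hR⟩ : ∃ R : ℝ → ℝ, R = fun s => Real.sqrt ((b s - β s) ^ 2 + 2 * (w s) ^ 2) := ⟨_, rfl⟩
  obtain ⟨U, hU⟩ : ∃ U : ℝ → ℝ, U = fun s => (b s - β s) / R s := ⟨_, rfl⟩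
  -- a gate phase `[0, T]` containing `σ`
  obtain ⟨T, hT0, hT1, hTB, hw1, hσT⟩ : ∃ T : ℝ, 0 < T ∧ T ≤ σ₁ ∧ B * T ≤ 5 * Real.log B + 20 ∧
      (∀ s ∈ Icc 0 T, 1 ≤ w s) ∧ σ ≤ T := by
    rcases pulse_first_passage b w β f₁ f₂ f₃ R U B q4 φ σ₁ hB hq1 hq2 hφ0 hφ1 hσ₁ hbc hwc hβc hbd
      hwd hβd hf hb0 hw0 hβ0 hR hU hσ₁0 with ⟨hall, hBσ₁⟩ | ⟨T, hT0, hTσ₁, hTB, hw1, hwT⟩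
    · exact ⟨σ₁, hσ₁0, le_rfl, hBσ₁, hall, hσ.2⟩
    · refine ⟨T, hT0, hTσ₁.le, hTB, hw1, ?_⟩
      by_contra! h
      obtain ⟨σm, -, -, -, -, -, -, -, -, -, hβT⟩ := pulse_gate_exit b w β f₁ f₂ f₃ R U B q4 φ
        σ₁ T hB hq1 hq2 hφ0 hφ1 hσ₁ hbc hwc hβc hbd hwd hβd hf hb0 hw0 hβ0 hR hU hT0 hTσ₁.le hTB hw1
        hwT
      linarith [hβ4 T ⟨hT0.le, h.le⟩]
  obtain ⟨-, huc, -, hRb⟩ := pulse_gate_radius b w β f₁ f₂ f₃ R U B q4 φ σ₁ T hB hq1 hq2 hφ0 hφ1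
    hσ₁ hbc hwc hβc hbd hwd hβd hf hb0 hw0 hβ0 hR hU hT0 hT1 hTB hw1
  obtain ⟨hclock, hcl⟩ := pulse_gate_clock b w β f₁ f₂ f₃ R U B q4 φ σ₁ T hB hq1 hq2 hφ0 hφ1 hσ₁
    hbc hwc hβc hbd hwd hβd hf hb0 hw0 hβ0 hR hU hT0 hT1 hTB hw1
  have hpt : ∀ x ∈ Icc 0 T, 0 < R x ∧ R x ^ 2 = (b x - β x) ^ 2 + 2 * (w x) ^ 2 ∧
      b x - β x = U x * R x ∧ -1 ≤ U x ∧ U x ≤ 1 ∧ 2 * (w x) ^ 2 = R x ^ 2 * (1 - (U x) ^ 2) ∧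
      (b x + β x - R x) * (b x + β x + R x) = 2 * (2 * b x * β x - (w x) ^ 2) := fun x hx =>
    pulse_gate_point (by linarith [hw1 x hx])
      (show Real.sqrt ((b x - β x) ^ 2 + 2 * (w x) ^ 2) = R x by rw [hR])
      (show U x = (b x - β x) / R x by rw [hU])
  have hI : Icc 0 σ ⊆ Icc 0 T := Icc_subset_Icc_right hσT
  -- `β ≤ B/4` keeps the clock in its first half: `1 - U ≤ 0.51`
  have hz : ∀ x ∈ Icc 0 σ, 1 - U x ≤ 51 / 100 := by
    intro x hx
    obtain ⟨hRpos, -, hD, -, -, -, -⟩ := hpt x (hI hx)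
    obtain ⟨hR1, -, -⟩ := hRb x (hI hx)
    obtain ⟨-, ⟨hXlo, -⟩, -⟩ := hcl x (hI hx)
    have hβx := hβ4 x hx
    have hβ : β x = (b x + β x - R x) / 2 + R x * (1 - U x) / 2 := by linarith
    have h1 : R x * (1 - U x) ≤ B / 2 + 43 / 250 := by linarith
    by_contra! h
    have h2 : 99 / 100 * B * (51 / 100) < R x * (1 - U x) := by
      calc 99 / 100 * B * (51 / 100) ≤ R x * (51 / 100) := by nlinarith
        _ < R x * (1 - U x) := mul_lt_mul_of_pos_left h hRpos
    linarith
  -- integrate `(1 - U)' ≥ K (1 - U) - ψ` on `[0, σ]`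
  have hzc : ContinuousOn (fun t => 1 - U t) (Icc 0 σ) := (continuousOn_const.sub huc).mono hI
  have hφc : ContinuousOn (fun t => 49 * B / 50 * (1 - U t) - 1 / (1000 * B)) (Icc 0 σ) :=
    (hzc.const_mul (49 * B / 50)).sub continuousOn_const
  have key := incubation_integral_le_sub hσ0.le hzc hφc (fun x hx => by
      obtain ⟨u', hu', hle⟩ := hclock x ⟨hx.1, hx.2.trans_le hσT⟩
      refine ⟨-u', hu'.const_sub 1, ?_⟩
      have hux : 0 ≤ U x := by linarith [hz x (Ioo_subset_Icc_self hx)]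
      obtain ⟨-, -, -, -, hu2, -⟩ := hpt x (hI (Ioo_subset_Icc_self hx))
      have : 49 * B / 50 * (1 - U x) ≤ 49 * B / 50 * (1 - U x ^ 2) := by
        apply mul_le_mul_of_nonneg_left _ (by positivity)
        nlinarith
      linarith)
  rw [intervalIntegral.integral_sub ((hzc.const_mul _).intervalIntegrable_of_Icc hσ0.le)
    (continuousOn_const.intervalIntegrable_of_Icc hσ0.le), intervalIntegral.integral_const_mul,
    intervalIntegral.integral_const, smul_eq_mul] at key
  simp only [sub_zero] at key
  have hz0' : 0 ≤ 1 - U 0 := by linarith [(hpt 0 (left_mem_Icc.2 hT0.le)).2.2.2.2.1]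
  have hzσ := hz σ (right_mem_Icc.2 hσ0.le)
  have hψ : σ * (1 / (1000 * B)) ≤ 1 / 100000 := by
    rw [mul_one_div, div_le_div_iff₀ (by positivity) (by norm_num)]; nlinarith [hσ.2]
  have hint : ∫ x in (0 : ℝ)..σ, (1 - U x) ≤ (51 / 100 + 1 / 100000) / (49 * B / 50) := by
    rw [le_div_iff₀ hK0]; linarith
  -- `|β| ≤ 1/50 + 0.5005 B (1 - U)`
  have hβabs : ∀ x ∈ Icc 0 σ, |β x| ≤ 1 / 50 + 1001 / 2000 * B * (1 - U x) := fun x hx =>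
    (hcl x (hI hx)).2.2.2.1
  have hgc : ContinuousOn (fun x => 1 / 50 + 1001 / 2000 * B * (1 - U x)) (Icc 0 σ) :=
    continuousOn_const.add (hzc.const_mul _)
  have hmono : ∫ x in (0 : ℝ)..σ, |β x| ≤ ∫ x in (0 : ℝ)..σ, (1 / 50 + 1001 / 2000 * B * (1 - U x)) :=
    incubation_integral_mono hσ0.le (hβc.mono (hI.trans (Icc_subset_Icc_right hT1))).abs hgc hβabs
  rw [intervalIntegral.integral_add (continuousOn_const.intervalIntegrable_of_Icc hσ0.le)
    ((hzc.const_mul _).intervalIntegrable_of_Icc hσ0.le),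
    intervalIntegral.integral_const, smul_eq_mul, intervalIntegral.integral_const_mul] at hmono
  have e1 : 1001 / 2000 * B * ((51 / 100 + 1 / 100000) / (49 * B / 50)) =
      1001 / 1960 * (51 / 100 + 1 / 100000) := by
    field_simp
    ring
  have h3 := mul_le_mul_of_nonneg_left hint (by positivity : (0 : ℝ) ≤ 1001 / 2000 * B)
  rw [e1] at h3
  linarith [hσ.2]

end Summit.NavierStokesRegularity.NavierStokesRegularity.Theorems.PerpetualPumpAveragedTypeIBlowup

end
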